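import Mathlib
import Literature.MathematicalPhysics.QuantumFieldTheory.Balaban1983to89.B16SupCountBranching

/-!
# `Balaban1983to89.B16.SupCountHalfLattice` — the HALF-LATTICE family of tree graphs (segments of sup-length ½ from a
cube centre to a vertex of that cube), the family that refutes the conjectured tree slope 2^d − 1, has optimal slope
EXACTLY 35/2 at d = 4 and EXACTLY 15/2 at d = 3: a face identity for the cubes at a set of vertices of one cube, the
table entry U₄(4) = 51 by kernel enumeration, and a chain count over the centres

CITATION HEADER (lean-in-tree rule 2026-08-18).  Sources, exactly as in the header of `…B16.SupCountBranching`, which this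
module continues: T. Bałaban, *Large field renormalization. II. Localization, exponentiation, and bounds for the 𝐑
operation*, Commun. Math. Phys. **122**, 355–392 (1989) [Balaban1989LargeFieldII] (cell paper B16; held
`paper:balaban1989-cmp122-large-field-ii`, journal page = PDF page + 354): p. 385 [PDF 31] prints the count of M-cubes met
by a tree graph as «7^d(3·2^{d−1}d′₁(Z₁^{(i)}) + 2^d)» (slope 3·2^{d−1} = 24 at d = 4, additive 2^d), and (1.93) p. 388
[PDF 34] uses the reciprocal constant (3·2^d)^{−1}; T. Bałaban, *Renormalization group approach to lattice gauge field
theories. I*, Commun. Math. Phys. **109**, 249–301 (1987) [Balaban1987RG1] p. 257 (linear size of a localization domain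
through tree graphs; no metric named — cell DIVERGENCE.md D-T2); J. Dimock, *The renormalization group according to
Bałaban II. Large fields*, J. Math. Phys. **54**, 092301 (2013), arXiv:1212.5562v2 [Dimock2013BalabanII] App. E (sup-metric
convention of the typed model).  The Bałaban papers are manuscripts UNDER ADJUDICATION by the audit cell `pub-balaban`:
nothing printed in them is asserted here; no passage is quoted beyond the two constants above (quoted in the imported
header); every `theorem` below is an elementary statement about unit cubes of ℤ^d ⊂ ℝ^d and explicit finite families of
segments in the cell's typed model, proved without `sorry` and without new axioms.  All finite checks are `decide`
(kernel evaluation of `Decidable` instances — no `native_decide`, no `Lean.ofReduceBool`); the largest, `faces_four_codes`,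
runs over the 1820 four-subsets of the 16 vertex codes of [0,1]^4.  NEW leaf module of unit `b2b-balaban-b01` (gen 24; cell
records GAPS.md C-b01g24-1, DIVERGENCE.md D-b01g15.1 UPDATE-4; v1.1 = v1 + Part 8, append-only, after cross-read C-pv22g18-4); it imports `…B16.SupCountBranching` (unit b01, gen 23;
through it `…B16.SupCountCeiling`, `…B16.SupCountFloor`, `…TreeLength`) and modifies nothing.  No statement in print is
known to the cell for the questions decided here (presearch of gens 15/22/23: nearest is the d = 2 EUCLIDEAN pixel count of
Gerard–Vacavant–Favreau, Theoret. Comput. Sci. **624** (2016) 41–55, other metric; the face count of Part 1 is elementary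
cube combinatorics); all statements are tagged [folklore].

THE TYPED MODEL (`…TreeLength`): closed unit cubes `cube y = [y, y + 1]^d`, y ∈ ℤ^d, of ℝ^d with Mathlib's SUP metric; a
polygonal graph is a list T of segments, `len T` the sum of their sup-lengths, `carrier T` their union; `SAdmissible Y T` =
the carrier is connected and meets every cube of Y.  STATE BEFORE THIS MODULE (`…B16.SupCountBranching`): for a count
`SAdmissible Y T → #Y ≤ c·len T + 2^d` valid for ALL connected graphs the optimal slope satisfies 35/2 ≤ c_4 ≤ 30 at d = 4
(`tree_slope_bracket_four`) and c_3 ≥ 15/2 at d = 3 (`tree_count_floor_three`; ceiling 2(2^3 − 1) = 14 from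
`…SupCountCeiling`), the floors coming from CENTRE STARS (`ctrStar S`: segments from the centre of the cube of index 0 to
vertices S of that cube; `touch s` = the 2^d cubes having the lattice point s as a vertex, `starCubes S` their union over
S); and its header records, OUTSIDE Lean (cell records `pub-balaban/b2b-balaban-b01-g23/slope/`: a rooted-tree
subadditivity bound plus a two-engine table U₄(k) of maximal unions of k vertex stars of one cube), that 35/2 is the EXACT
optimum of (#Y − 16)/len over the sub-family of trees whose segments join a cube centre to a vertex of the same cube.
THIS MODULE PROVES THAT RECORDED ASSERTION IN THE KERNEL (and its d = 3 analogue, 15/2).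

THE OBJECTS.  A HALF-LATTICE EDGE is a pair e = (c, s) ∈ ℤ^d × ℤ^d with s a vertex of the cube of index c (`IsHL e`, i.e.
`IsVertexOf c s`: s_μ ∈ {c_μ, c_μ + 1}); its segment `hseg e = [ctr c, corner s]` runs from the centre of cube c to s and has
sup-length exactly ½ (`dist_hseg`, d ≥ 1); `hgraph E` is the polygonal graph of a list E of edges (`len_hgraph`: len =
#E/2; repeated edges are allowed and only lengthen the graph).  These are exactly the graphs all of whose segments have
sup-length ½ and join a cube centre to a lattice point (centre-to-centre and lattice-point-to-lattice-point sup-distances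
are ≥ 1), each segment oriented centre → vertex (orientation changes neither `carrier` nor `len`).  For B ⊆ {0,1}^d and
J ⊆ {1,…,d}, `enc J b` is the cube index with entries 2b_μ − 1 ∈ {−1, 1} for μ ∈ J and 0 for μ ∉ J — the cube attached to
[0,1]^d across its face {x_μ = b_μ (μ ∈ J)} of codimension #J.

WHAT IS PROVED.
(1) FACES (any d; Part 1).  For b ∈ {0,1}^d a cube index y lies in `touch b` iff y = enc (supp y) b
  (`mem_touch_iff_eq_enc`); hence `biUnion_touch_eq` / `card_biUnion_touch_eq` — THE FACE IDENTITY
  #(⋃_{b ∈ B} touch b) = Σ_{J ⊆ {1..d}} #(B.image (enc J)): the unit cubes having a vertex in B ⊆ {0,1}^d correspond one-to-one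
  to the faces of [0,1]^d (of every dimension, 3^d in all, the cube and its vertices included) that contain a point of B,
  the faces of direction class J being counted by the projection of B to the coordinates J — and THE FACE BOUND
  `card_biUnion_touch_le_faces`: ≤ Σ_J min(#B, 2^{#J}) (`card_faceClass`: the class J has 2^{#J} cubes).
(2) THE TABLES (Part 2).  Grouped by dimension the face bound is F3(k) = Σ_j C(3,j) min(k, 2^j) = 8, 15, 19, 23, 24, 25, … ≤ 27
  at d = 3 and F4(k) = Σ_j C(4,j) min(k, 2^j) = 16, 31, 42, 53, 58, 63, 68, 73, … ≤ 81 at d = 4 (`sum_min_eq_F3/F4`,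
  `F3_values`, `F4_values`, `F3_le`, `F4_le`), whence 4·F3(k) ≤ 32 + 15k for k ≥ 1 and 4·F4(k) ≤ 64 + 35k for k ≥ 1, k ≠ 4
  (`four_mul_F3_le`, `four_mul_F4_le`; at k = 4, d = 4 the face bound 53 is too weak: 212 > 204).  THE TABLE ENTRY U₄(4) = 51:
  `card_biUnion_touch_le_of_card_four` — four vertices of [0,1]^4 lie on at most 51 unit cubes (attained by the code `S4` =
  {0100, 0111, 1001, 1010}, `SupCountBranching.card_starCubes_S4`); proof: by the face identity the count is Σ_J #(B.image
  (enc J)), the class-J image of a vertex depends exactly on its 4-bit code masked to J (`enc_dec_land`,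
  `land_eq_of_enc_dec_eq`, kernel checks over 16·16 and 16·16·16 cases), and `faces_four_codes` checks Σ_J #{masked codes}
  ≤ 51 for all 1820 four-subsets of the codes (kernel `decide`; the four codes are produced increasing by
  `Finset.orderEmbOfFin`).
(3) THE BLOCK BOUNDS (Part 3; translation `touch_add_right`, `exists_bin_of_vertexSet`): k ≥ 1 vertices of ONE unit cube lie
  on at most 8 + 15k/4 unit cubes at d = 3 (`block_bound_three`: 4·U ≤ 32 + 15k, equality at k = 4) and on at most 16 + 35k/4
  unit cubes at d = 4 (`block_bound_four`: 4·U ≤ 64 + 35k, equality at k = 4; k = 3: 168 ≤ 169).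
(4) GEOMETRY OF AN EDGE (any d; Part 4).  A point of the segment of (c, s) lies in the OPEN cube of index c or is the vertex s
  (`mem_segment_hseg`); so a unit cube meeting that segment is one of the 2^d cubes at s (`mem_touch_of_meets` — the cube c
  itself is one of them), and two edge segments with different centres meet only at a common vertex end
  (`snd_eq_of_mem_segment`, d ≥ 1).
(5) THE CHAIN COUNT (any d; Parts 5–6).  `chain_count`: if each centre c obeys q·#(cubes at the vertex ends of its edges) ≤
  q·2^d + a·#(edges at c), and every proper non-empty set R of centres has an edge whose vertex end is also the vertex end
  of an edge with centre outside R, then q·#(all cubes at vertex ends) ≤ q·2^d + a·#edges — grow R one centre at a time;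
  the 2^d cubes at the shared vertex are common to the old block and the new one and pay the additive q·2^d of the new block
  (growing-set induction on #(centres ∖ R)).  `shared_vertex_of_isPreconnected`: connectedness of the carrier supplies the
  shared vertex ends (the closed cover of the carrier by the segments with centre in R and those with centre outside R must
  overlap, `isPreconnected_closed_iff` + `isClosed_carrier` + (4)); `subset_cubesAt`: the cubes met are among the cubes at
  the vertex ends (by (4)); together `halfLattice_count`: under a vertex-set bound q·U ≤ q·2^d + a·k for one cube, every
  connected half-lattice graph with n edges satisfies q·#Y ≤ q·2^d + a·n.
(6) d = 3 AND d = 4 (Part 7).  `four_mul_card_le_three/four` (4·#Y ≤ 32 + 15n, resp. 64 + 35n), `halfLattice_count_three`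
  (#Y ≤ (15/2)·len T + 2^3), `halfLattice_count_four` (#Y ≤ (35/2)·len T + 2^4); the stars `S3`, `S4` are half-lattice graphs
  (`hgraph_E3 = ctrStar S3`, `hgraph_E4 = ctrStar S4`), so no smaller slope is valid on the family
  (`halfLattice_floor_three/four`: 23 ≤ 2c + 8, 51 ≤ 2c + 16); `halfLattice_slope_three`: IsLeast … (15/2) and
  `halfLattice_slope_four`: IsLeast … (35/2) — THE OPTIMAL SLOPES OF THE HALF-LATTICE FAMILY ARE EXACTLY 15/2 (d = 3) AND
  35/2 (d = 4), the lower ends of the kernel brackets [15/2, 14] and [35/2, 30] for all connected graphs;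
  `halfLattice_printed_slope_four`: on the family the count with the PRINTED slope 3·2^{4−1} = 24 holds, #Y ≤ 24·len T + 2^4
  (room 13/2 per unit length) — the family that refutes the conjectured slope 2^4 − 1 = 15 does not refute the printed 24.
(7) v1.1 (APPEND-ONLY Part 8; types XREAD INFO I-1 of cell record C-pv22g18-4): THE FAMILY IS CHARACTERISED BY SUP-LENGTH
  (d ≥ 1) — among all segments from a cube centre `ctr c` to a lattice point `corner s`, the half-lattice edges are EXACTLY
  those of sup-length ½ (`isHL_iff_dist_eq_half`: every coordinate gap |c_μ + ½ − s_μ| is a half-integer ≥ ½, and it is ½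
  in every coordinate iff s is a vertex of c, `vertex_coord_of_abs_le_half`), and every other centre-to-lattice-point
  segment has sup-length ≥ 3/2 (`three_halves_le_dist_of_not_isHL`); so «the connected polygonal graphs all of whose
  segments have sup-length ½ and join a cube centre to a lattice point» of the title ARE the graphs `hgraph E` with
  `∀ e ∈ E, IsHL e` (`isHL_of_forall_dist`, stated for lists of centre/lattice-point pairs).
WHAT IS *NOT* PROVED: anything new about connected graphs OUTSIDE the half-lattice family (hubs off the cube centres, joints
off the lattice, longer segments) — the brackets [15/2, 14] (d = 3) and [35/2, 30] (d = 4) of `…SupCountBranching` /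
`…SupCountCeiling` are all that is kernel-checked for them, so neither c_4 = 35/2 nor any tree ceiling below 30 is claimed;
whether the printed slope 24 holds verbatim for all trees in the sup typing REMAINS OPEN (numerical searches outside the
family are cell records of gen 24, `pub-balaban/b2b-balaban-b01-g24/offlat/`, not theorems; by GAPS C-b01g15-3 A1 the slope
is not load-bearing for (1.93)/(1.97)); other dimensions (the face identity, the edge geometry and the chain count are typed
for every d, the tables and block constants only for d = 3, 4; the optimal vertex-set constant max_k (U_d(k) − 2^d)/k for
d ≥ 5 is not computed); Euclidean / ℓ¹ lengths (not typed).  Value: kernel-checked bookkeeping — the cell's recorded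
in-family optimum made a theorem, with the threat to the printed constant from this family closed — NOT summit progress, NOT
a claim about the manuscripts.
-/

namespace Literature.MathematicalPhysics.QuantumFieldTheory.Balaban1983to89.B16.SupCountHalfLattice

variable {d : ℕ}

open Literature.MathematicalPhysics.QuantumFieldTheory.Balaban1983to89.B13ScaleTransfer (Pt)
open Literature.MathematicalPhysics.QuantumFieldTheory.Balaban1983to89.TreeLength
open Literature.MathematicalPhysics.QuantumFieldTheory.Balaban1983to89.B16.SupCountCeiling (ctr)
open Literature.MathematicalPhysics.QuantumFieldTheory.Balaban1983to89.B16.SupCountBranching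
open Finset

/-! ## Part 1. Faces: the cubes at a set of vertices of the cube of index 0, counted face by face -/

/-- A 0/1 vector: a vertex of the cube of index 0. [folklore] -/
def IsBin (b : Pt d) : Prop := ∀ i, b i = 0 ∨ b i = 1

/-- The cube attached to the face class J through the vertex b: index 2b_μ − 1 ∈ {−1, 1} for μ ∈ J (committed
directions) and 0 for μ ∉ J (free directions). [folklore] -/
def enc (J : Finset (Fin d)) (b : Pt d) : Pt d := fun i => if i ∈ J then 2 * b i - 1 else 0

/-- The support of a cube index. [folklore] -/
def supp (y : Pt d) : Finset (Fin d) := univ.filter fun i => y i ≠ 0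

/-- `enc J b` has support exactly J (its entries on J are odd). [folklore] -/
theorem supp_enc (J : Finset (Fin d)) (b : Pt d) : supp (enc J b) = J := by
  ext i
  simp only [supp, enc, mem_filter, mem_univ, true_and]
  by_cases h : i ∈ J <;> simp [h]
  omega

/-- A cube is at the vertex b ∈ {0,1}^d iff it is the cube attached to the face class (supp y) through b. [folklore] -/
theorem mem_touch_iff_eq_enc {b y : Pt d} (hb : IsBin b) : y ∈ touch b ↔ y = enc (supp y) b := by
  rw [mem_touch]
  constructor
  · intro h
    funext i
    simp only [enc, supp, mem_filter, mem_univ, true_and]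
    rcases hb i with hb | hb <;> rcases h i with h | h <;> simp [h, hb]
  · intro h i
    rw [h]
    by_cases hi : i ∈ supp y <;> rcases hb i with hb | hb <;> simp [enc, hi, hb]

/-- FACE DECOMPOSITION: the cubes at a set B of vertices of the cube of index 0 are, face class by face class,
the cubes attached to the faces through the points of B. [folklore] -/
theorem biUnion_touch_eq (B : Finset (Pt d)) (hB : ∀ b ∈ B, IsBin b) :
    B.biUnion touch = (univ : Finset (Finset (Fin d))).biUnion fun J => B.image (enc J) := by
  ext y
  simp only [mem_biUnion, mem_image, mem_univ, true_and]
  constructor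
  · rintro ⟨b, hb, hy⟩
    exact ⟨supp y, b, hb, ((mem_touch_iff_eq_enc (hB b hb)).1 hy).symm⟩
  · rintro ⟨J, b, hb, rfl⟩
    refine ⟨b, hb, (mem_touch_iff_eq_enc (hB b hb)).2 ?_⟩
    rw [supp_enc]

/-- THE FACE IDENTITY: for B ⊆ {0,1}^d, #(⋃_{b ∈ B} touch b) = Σ_J #(B.image (enc J)) — the number of unit cubes
having a vertex in B equals the number of faces of [0,1]^d (of every dimension, the cube itself and its vertices
included; 3^d in all) containing a point of B, the faces of class J being counted by the projection of B onto the
coordinates J. [folklore] -/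
theorem card_biUnion_touch_eq (B : Finset (Pt d)) (hB : ∀ b ∈ B, IsBin b) :
    (B.biUnion touch).card = ∑ J : Finset (Fin d), (B.image (enc J)).card := by
  rw [biUnion_touch_eq B hB, card_biUnion]
  intro J _ J' _ hJJ'
  refine disjoint_left.2 fun y hy hy' => hJJ' ?_
  obtain ⟨b, -, rfl⟩ := mem_image.1 hy
  obtain ⟨b', -, h⟩ := mem_image.1 hy'
  rw [← supp_enc J b, ← h, supp_enc]

/-- A face class through #B points has at most #B members. [folklore] -/
theorem card_image_enc_le_card (J : Finset (Fin d)) (B : Finset (Pt d)) : (B.image (enc J)).card ≤ B.card :=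
  card_image_le

/-- The cubes of face class J: entries ±1 on J, 0 off J. [folklore] -/
def faceClass (J : Finset (Fin d)) : Finset (Pt d) :=
  Fintype.piFinset fun i => if i ∈ J then ({-1, 1} : Finset ℤ) else {0}

/-- The face class J has 2^{#J} cubes. [folklore] -/
theorem card_faceClass (J : Finset (Fin d)) : (faceClass J).card = 2 ^ J.card := by
  rw [faceClass, Fintype.card_piFinset]
  have h : ∀ i, (if i ∈ J then ({-1, 1} : Finset ℤ) else {0}).card = if i ∈ J then 2 else 1 := by
    intro i
    split_ifs <;> simp
  simp_rw [h, Fintype.prod_ite_mem, prod_const]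

/-- The cubes attached to faces of class J lie in the face class J. [folklore] -/
theorem image_enc_subset_faceClass (J : Finset (Fin d)) (B : Finset (Pt d)) (hB : ∀ b ∈ B, IsBin b) :
    B.image (enc J) ⊆ faceClass J := by
  intro y hy
  obtain ⟨b, hb, rfl⟩ := mem_image.1 hy
  simp only [faceClass, Fintype.mem_piFinset]
  intro i
  by_cases hi : i ∈ J <;> rcases hB b hb i with h | h <;> simp [enc, hi, h]

/-- A face class J through B has at most 2^{#J} members. [folklore] -/
theorem card_image_enc_le_pow (J : Finset (Fin d)) (B : Finset (Pt d)) (hB : ∀ b ∈ B, IsBin b) :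
    (B.image (enc J)).card ≤ 2 ^ J.card :=
  (card_le_card (image_enc_subset_faceClass J B hB)).trans (card_faceClass J).le

/-- THE FACE BOUND: #(⋃_{b ∈ B} touch b) ≤ Σ_J min(#B, 2^{#J}) for B ⊆ {0,1}^d. [folklore] -/
theorem card_biUnion_touch_le_faces (B : Finset (Pt d)) (hB : ∀ b ∈ B, IsBin b) :
    (B.biUnion touch).card ≤ ∑ J : Finset (Fin d), min B.card (2 ^ J.card) := by
  rw [card_biUnion_touch_eq B hB]
  exact sum_le_sum fun J _ => le_min (card_image_enc_le_card J B) (card_image_enc_le_pow J B hB)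

/-! ## Part 2. d = 3 and d = 4: the face bound as a function of k = #B, and the table entry U₄(4) = 51 -/

/-- The face bound at d = 4: F4(k) = Σ_j C(4,j)·min(k, 2^j). [folklore] -/
def F4 (k : ℕ) : ℕ := ∑ j ∈ range 5, Nat.choose 4 j * min k (2 ^ j)

/-- Grouping the face classes by dimension. [folklore] -/
theorem sum_min_eq_F4 (k : ℕ) : ∑ J : Finset (Fin 4), min k (2 ^ J.card) = F4 k := by
  rw [← Finset.powerset_univ, Finset.sum_powerset_apply_card (fun m => min k (2 ^ m))]
  simp [F4]

/-- Values of the face bound: F4(1..8) = 16, 31, 42, 53, 58, 63, 68, 73. [folklore] -/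
theorem F4_values : F4 1 = 16 ∧ F4 2 = 31 ∧ F4 3 = 42 ∧ F4 4 = 53 ∧ F4 5 = 58 ∧ F4 6 = 63 ∧ F4 7 = 68 ∧ F4 8 = 73 := by
  decide

/-- The face bound never exceeds 3^4 = 81 (all faces). [folklore] -/
theorem F4_le (k : ℕ) : F4 k ≤ 81 :=
  calc F4 k ≤ ∑ j ∈ range 5, Nat.choose 4 j * 2 ^ j := sum_le_sum fun j _ => Nat.mul_le_mul_left _ (min_le_right _ _)
    _ = 81 := by decide

/-- The face bound at d = 4 for a k-set, k ≠ 4: 4·F4(k) ≤ 64 + 35k (k = 3: 168 ≤ 169). [folklore] -/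
theorem four_mul_F4_le (k : ℕ) (hk : 1 ≤ k) (h4 : k ≠ 4) : 4 * F4 k ≤ 64 + 35 * k := by
  rcases Nat.lt_or_ge k 8 with h | h
  · interval_cases k <;> simp_all <;> decide
  · have := F4_le k
    omega

/-- The face bound is linear with slope 37 in the worst case k = 4 (4·53 = 212 = 64 + 37·4). [folklore] -/
theorem four_mul_F4_le' (k : ℕ) (hk : 1 ≤ k) : 4 * F4 k ≤ 64 + 37 * k := by
  rcases Nat.lt_or_ge k 8 with h | h
  · interval_cases k <;> decide
  · have := F4_le k
    omega

/-- The face bound at d = 3: F3(k) = Σ_j C(3,j)·min(k, 2^j). [folklore] -/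
def F3 (k : ℕ) : ℕ := ∑ j ∈ range 4, Nat.choose 3 j * min k (2 ^ j)

/-- Grouping the face classes by dimension (d = 3). [folklore] -/
theorem sum_min_eq_F3 (k : ℕ) : ∑ J : Finset (Fin 3), min k (2 ^ J.card) = F3 k := by
  rw [← Finset.powerset_univ, Finset.sum_powerset_apply_card (fun m => min k (2 ^ m))]
  simp [F3]

/-- Values of the face bound at d = 3: F3(1..6) = 8, 15, 19, 23, 24, 25 (F3(4) = 23 is attained by the even-weight code
`SupCountBranching.S3`). [folklore] -/
theorem F3_values : F3 1 = 8 ∧ F3 2 = 15 ∧ F3 3 = 19 ∧ F3 4 = 23 ∧ F3 5 = 24 ∧ F3 6 = 25 := by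
  decide

/-- The face bound at d = 3 never exceeds 3^3 = 27. [folklore] -/
theorem F3_le (k : ℕ) : F3 k ≤ 27 :=
  calc F3 k ≤ ∑ j ∈ range 4, Nat.choose 3 j * 2 ^ j := sum_le_sum fun j _ => Nat.mul_le_mul_left _ (min_le_right _ _)
    _ = 27 := by decide

/-- The face bound at d = 3 is linear with slope 15/4 per vertex: 4·F3(k) ≤ 32 + 15k (equality at k = 4; k = 3: 76 ≤ 77).
[folklore] -/
theorem four_mul_F3_le (k : ℕ) (hk : 1 ≤ k) : 4 * F3 k ≤ 32 + 15 * k := by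
  rcases Nat.lt_or_ge k 6 with h | h
  · interval_cases k <;> decide
  · have := F3_le k
    omega

/-- Binary code of a 0/1 vector of length 4. [folklore] -/
def code (b : Pt 4) : ℕ :=
  (if b 0 = 1 then 1 else 0) + (if b 1 = 1 then 2 else 0) + (if b 2 = 1 then 4 else 0) + (if b 3 = 1 then 8 else 0)

/-- Decoding. [folklore] -/
def dec (n : ℕ) : Pt 4 := ![((n % 2 : ℕ) : ℤ), ((n / 2 % 2 : ℕ) : ℤ), ((n / 4 % 2 : ℕ) : ℤ), ((n / 8 % 2 : ℕ) : ℤ)]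

/-- Codes are < 16. [folklore] -/
theorem code_lt (b : Pt 4) : code b < 16 := by
  simp only [code]
  split_ifs <;> omega

/-- Decoding inverts coding on 0/1 vectors. [folklore] -/
theorem dec_code {b : Pt 4} (hb : IsBin b) : dec (code b) = b := by
  rcases hb 0 with h0 | h0 <;> rcases hb 1 with h1 | h1 <;> rcases hb 2 with h2 | h2 <;> rcases hb 3 with h3 | h3 <;>
    (funext i; fin_cases i <;> simp [dec, code, h0, h1, h2, h3])

/-- The bit mask of a set of coordinates. [folklore] -/
def mask (J : Finset (Fin 4)) : ℕ := ∑ i ∈ J, 2 ^ (i : ℕ)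

/-- The face class J of a decoded vertex depends only on the masked code (kernel check over the 16 × 16 cases).
[folklore] -/
theorem enc_dec_land : ∀ J : Finset (Fin 4), ∀ n < 16, enc J (dec n) = enc J (dec (n &&& mask J)) := by
  decide

/-- … and determines it (kernel check over the 16 × 16 × 16 cases). [folklore] -/
theorem land_eq_of_enc_dec_eq : ∀ J : Finset (Fin 4), ∀ n < 16, ∀ n' < 16,
    enc J (dec (n &&& mask J)) = enc J (dec (n' &&& mask J)) → n &&& mask J = n' &&& mask J := by
  decide

/-- THE TABLE ENTRY U₄(4) = 51, computational core: for every 4-subset {a > b > c > e} of the 16 codes, the number of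
faces met, counted as masked-code classes, is at most 51 (kernel check over the 1820 subsets). [folklore] -/
theorem faces_four_codes : ∀ a < 16, ∀ b < a, ∀ c < b, ∀ e < c,
    ∑ J : Finset (Fin 4), (({a, b, c, e} : Finset ℕ).image (· &&& mask J)).card ≤ 51 := by
  decide

/-- U₄(4) ≤ 51: four vertices of [0,1]^4 lie on at most 51 of the 81 unit cubes at its vertices (the value 51 is
attained by the code `S4` = {0100, 0111, 1001, 1010}, `SupCountBranching.card_starCubes_S4`). [folklore] -/
theorem card_biUnion_touch_le_of_card_four (B : Finset (Pt 4)) (hB : ∀ b ∈ B, IsBin b) (h4 : B.card = 4) :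
    (B.biUnion touch).card ≤ 51 := by
  classical
  rw [card_biUnion_touch_eq B hB]
  obtain ⟨S, hS⟩ : ∃ S : Finset ℕ, S = B.image code := ⟨_, rfl⟩
  have hinj : Set.InjOn code B := by
    intro b hb b' hb' h
    rw [← dec_code (hB b hb), ← dec_code (hB b' hb'), h]
  have hScard : S.card = 4 := by rw [hS, card_image_of_injOn hinj, h4]
  have hS16 : ∀ n ∈ S, n < 16 := by
    intro n hn
    rw [hS] at hn
    obtain ⟨b, -, rfl⟩ := mem_image.1 hn
    exact code_lt b
  have hBS : B = S.image dec := by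
    rw [hS, image_image]
    ext b
    constructor
    · intro hb
      exact mem_image.2 ⟨b, hb, by rw [Function.comp_apply, dec_code (hB b hb)]⟩
    · intro hb
      obtain ⟨b', hb', rfl⟩ := mem_image.1 hb
      rw [Function.comp_apply, dec_code (hB b' hb')]
      exact hb'
  have hJ : ∀ J : Finset (Fin 4), (B.image (enc J)).card = (S.image (· &&& mask J)).card := by
    intro J
    rw [hBS, image_image]
    have h1 : S.image (enc J ∘ dec) = (S.image (· &&& mask J)).image (enc J ∘ dec) := by
      rw [image_image]
      apply image_congr
      intro n hn
      simpa [Function.comp] using enc_dec_land J n (hS16 n hn)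
    rw [h1, card_image_of_injOn]
    intro x hx x' hx' h
    obtain ⟨n, hn, rfl⟩ := mem_image.1 (mem_coe.1 hx)
    obtain ⟨n', hn', rfl⟩ := mem_image.1 (mem_coe.1 hx')
    exact land_eq_of_enc_dec_eq J n (hS16 n hn) n' (hS16 n' hn') h
  simp_rw [hJ]
  obtain ⟨f, hfS, hfmono⟩ : ∃ f : Fin 4 → ℕ, Set.range f = ↑S ∧ StrictMono f :=
    ⟨S.orderEmbOfFin hScard, Finset.range_orderEmbOfFin S hScard, (S.orderEmbOfFin hScard).strictMono⟩
  have hmem : ∀ i, f i ∈ S := fun i => by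
    have hi : f i ∈ Set.range f := ⟨i, rfl⟩
    rw [hfS] at hi
    exact hi
  have hSeq : S = {f 3, f 2, f 1, f 0} := by
    ext n
    rw [← mem_coe, ← hfS, Set.mem_range]
    constructor
    · rintro ⟨i, rfl⟩
      fin_cases i <;> simp
    · intro hn
      simp only [mem_insert, mem_singleton] at hn
      rcases hn with rfl | rfl | rfl | rfl <;> exact ⟨_, rfl⟩
  rw [hSeq]
  exact faces_four_codes (f 3) (hS16 _ (hmem 3)) (f 2) (hfmono (by decide)) (f 1) (hfmono (by decide))
    (f 0) (hfmono (by decide))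

/-! ## Part 3. Translation to an arbitrary cube, and the block bound at d = 4 -/

/-- s is a vertex of the cube of index c: s_μ ∈ {c_μ, c_μ + 1}. [folklore] -/
def IsVertexOf (c s : Pt d) : Prop := ∀ i, s i = c i ∨ s i = c i + 1

/-- The cubes at a translated vertex are the translated cubes. [folklore] -/
theorem touch_add_right (b c : Pt d) : touch (b + c) = (touch b).image (· + c) := by
  ext y
  simp only [mem_touch, mem_image, Pi.add_apply]
  constructor
  · intro h
    refine ⟨y - c, ?_, sub_add_cancel y c⟩
    intro i
    have := h i
    simp only [Pi.sub_apply]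
    omega
  · rintro ⟨x, hx, rfl⟩ i
    have := hx i
    simp only [Pi.add_apply]
    omega

/-- Translation does not change the number of cubes at a set of vertices. [folklore] -/
theorem card_biUnion_touch_image_add (N : Finset (Pt d)) (c : Pt d) :
    ((N.image (· + c)).biUnion touch).card = (N.biUnion touch).card := by
  rw [image_biUnion]
  simp_rw [touch_add_right]
  rw [← biUnion_image, card_image_of_injective _ (add_left_injective c)]

/-- A set of vertices of one cube is a translate of a subset of {0,1}^d of the same size, with as many cubes at it.
[folklore] -/
theorem exists_bin_of_vertexSet (c : Pt d) (N : Finset (Pt d)) (hN : ∀ s ∈ N, IsVertexOf c s) :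
    ∃ B : Finset (Pt d), (∀ b ∈ B, IsBin b) ∧ B.card = N.card ∧ (B.biUnion touch).card = (N.biUnion touch).card := by
  classical
  refine ⟨N.image (· - c), ?_, card_image_of_injective _ sub_left_injective, ?_⟩
  · intro b hb
    obtain ⟨s, hs, rfl⟩ := mem_image.1 hb
    intro i
    have := hN s hs i
    simp only [Pi.sub_apply]
    omega
  · have hNB : N = (N.image (· - c)).image (· + c) := by
      rw [image_image]
      have : ((fun x : Pt d => x + c) ∘ fun x => x - c) = id := by
        funext x
        simp
      rw [this, image_id]
    conv_rhs => rw [hNB]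
    rw [card_biUnion_touch_image_add]

/-- THE BLOCK BOUND at d = 3: k ≥ 1 vertices of one unit cube lie on at most 8 + 15k/4 unit cubes, i.e. 4·U ≤ 32 + 15k
(the face bound; equality at k = 4, the even-weight code). [folklore] -/
theorem block_bound_three (c : Pt 3) (N : Finset (Pt 3)) (hN : ∀ s ∈ N, IsVertexOf c s) (hne : N.Nonempty) :
    4 * (N.biUnion touch).card ≤ 32 + 15 * N.card := by
  obtain ⟨B, hBbin, hcard, hU⟩ := exists_bin_of_vertexSet c N hN
  rw [← hU, ← hcard]
  have hk : 1 ≤ B.card := by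
    rw [hcard]
    exact hne.card_pos
  calc 4 * (B.biUnion touch).card ≤ 4 * F3 B.card := by
        have := card_biUnion_touch_le_faces B hBbin
        rw [sum_min_eq_F3] at this
        omega
    _ ≤ 32 + 15 * B.card := four_mul_F3_le B.card hk

/-- THE BLOCK BOUND at d = 4: k ≥ 1 vertices of one unit cube lie on at most 16 + 35k/4 unit cubes, i.e. 4·U ≤ 64 + 35k
(the face bound for k ≠ 4; the kernel table entry U₄(4) = 51 for k = 4, where it is an equality; k = 3: 168 ≤ 169).
[folklore] -/
theorem block_bound_four (c : Pt 4) (N : Finset (Pt 4)) (hN : ∀ s ∈ N, IsVertexOf c s) (hne : N.Nonempty) :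
    4 * (N.biUnion touch).card ≤ 64 + 35 * N.card := by
  obtain ⟨B, hBbin, hcard, hU⟩ := exists_bin_of_vertexSet c N hN
  rw [← hU, ← hcard]
  have hk : 1 ≤ B.card := by
    rw [hcard]
    exact hne.card_pos
  by_cases h4 : B.card = 4
  · have := card_biUnion_touch_le_of_card_four B hBbin h4
    omega
  · calc 4 * (B.biUnion touch).card ≤ 4 * F4 B.card := by
          have := card_biUnion_touch_le_faces B hBbin
          rw [sum_min_eq_F4] at this
          omega
      _ ≤ 64 + 35 * B.card := four_mul_F4_le B.card hk h4

/-! ## Part 4. Half-lattice edges and their segments -/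

/-- A HALF-LATTICE EDGE (c, s): s is a vertex of the cube of index c; its segment joins the centre of that cube to s.
[folklore] -/
def IsHL (e : Pt d × Pt d) : Prop := IsVertexOf e.1 e.2

/-- The segment [centre of cube c, vertex s] of the edge (c, s). [folklore] -/
noncomputable def hseg (e : Pt d × Pt d) : Seg d := (ctr e.1, corner e.2)

/-- The polygonal graph of a list of half-lattice edges. [folklore] -/
noncomputable def hgraph (E : List (Pt d × Pt d)) : List (Seg d) := E.map hseg

/-- A half-lattice edge has sup-length ½ (d ≥ 1). [folklore] -/
theorem dist_hseg (hd : 0 < d) {e : Pt d × Pt d} (he : IsHL e) : dist (hseg e).1 (hseg e).2 = 1 / 2 := by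
  have hi : ∀ i, dist (ctr e.1 i) (corner e.2 i) = 1 / 2 := by
    intro i
    rw [Real.dist_eq, SupCountCeiling.ctr, corner]
    rcases he i with h | h <;> rw [h] <;> push_cast <;> norm_num [abs_of_nonneg]
  refine le_antisymm ((dist_pi_le_iff (by norm_num)).2 fun i => (hi i).le) ?_
  have h := dist_le_pi_dist (ctr e.1) (corner e.2) ⟨0, hd⟩
  rwa [hi] at h

/-- A half-lattice graph with n edges has sup-length n/2 (d ≥ 1). [folklore] -/
theorem len_hgraph (hd : 0 < d) {E : List (Pt d × Pt d)} (hE : ∀ e ∈ E, IsHL e) : len (hgraph E) = E.length / 2 := by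
  induction E with
  | nil => simp [hgraph]
  | cons e E ih =>
    have h1 : len (hgraph (e :: E)) = dist (hseg e).1 (hseg e).2 + len (hgraph E) := rfl
    rw [h1, dist_hseg hd (hE e (by simp)), ih fun e' he' => hE e' (by simp [he']), List.length_cons]
    push_cast
    ring

/-- Membership in the carrier of a half-lattice graph. [folklore] -/
theorem mem_carrier_hgraph {E : List (Pt d × Pt d)} {p : RPt d} :
    p ∈ carrier (hgraph E) ↔ ∃ e ∈ E, p ∈ segment ℝ (ctr e.1) (corner e.2) := by
  rw [hgraph, mem_carrier]
  simp [hseg]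

/-- A point of the segment of a half-lattice edge (c, s) is either in the OPEN cube of index c or the vertex s.
[folklore] -/
theorem mem_segment_hseg {e : Pt d × Pt d} (he : IsHL e) {p : RPt d} (hp : p ∈ segment ℝ (ctr e.1) (corner e.2)) :
    (∀ i, (e.1 i : ℝ) < p i ∧ p i < e.1 i + 1) ∨ p = corner e.2 := by
  rw [segment_eq_image'] at hp
  obtain ⟨t, ⟨ht0, ht1⟩, rfl⟩ := hp
  rcases eq_or_lt_of_le ht1 with rfl | ht1
  · right
    simp
  · left
    intro i
    simp only [Pi.add_apply, Pi.smul_apply, Pi.sub_apply, smul_eq_mul, SupCountCeiling.ctr, corner]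
    rcases he i with h | h <;> rw [h] <;> push_cast <;> constructor <;> nlinarith

/-- THE TILES OF AN EDGE: a unit cube meeting the segment of a half-lattice edge (c, s) is one of the 2^d cubes at the
vertex s (the cube c itself being one of them). [folklore] -/
theorem mem_touch_of_meets {e : Pt d × Pt d} (he : IsHL e) {y : Pt d} {p : RPt d}
    (hp : p ∈ segment ℝ (ctr e.1) (corner e.2)) (hpy : p ∈ cube y) : y ∈ touch e.2 := by
  rw [mem_touch]
  rw [mem_cube] at hpy
  rcases mem_segment_hseg he hp with h | rfl
  · intro i
    obtain ⟨h1, h2⟩ := h i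
    obtain ⟨h3, h4⟩ := hpy i
    have h5 : y i = e.1 i := by
      have h6 : (y i : ℝ) < e.1 i + 1 := by linarith
      have h7 : (e.1 i : ℝ) < y i + 1 := by linarith
      have h8 : y i < e.1 i + 1 := by exact_mod_cast h6
      have h9 : e.1 i < y i + 1 := by exact_mod_cast h7
      omega
    rcases he i with h | h <;> omega
  · intro i
    obtain ⟨h3, h4⟩ := hpy i
    simp only [corner] at h3 h4
    have h8 : y i ≤ e.2 i := by exact_mod_cast h3
    have h9 : e.2 i ≤ y i + 1 := by exact_mod_cast h4
    omega

/-- TWO EDGES WITH DIFFERENT CENTRES MEET ONLY AT A COMMON VERTEX END (d ≥ 1). [folklore] -/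
theorem snd_eq_of_mem_segment (hd : 0 < d) {e e' : Pt d × Pt d} (he : IsHL e) (he' : IsHL e') (hne : e.1 ≠ e'.1)
    {p : RPt d} (hp : p ∈ segment ℝ (ctr e.1) (corner e.2)) (hp' : p ∈ segment ℝ (ctr e'.1) (corner e'.2)) :
    e.2 = e'.2 := by
  rcases mem_segment_hseg he hp with h | rfl <;> rcases mem_segment_hseg he' hp' with h' | h'
  · exact absurd (funext fun i => by
      obtain ⟨h1, h2⟩ := h i
      obtain ⟨h3, h4⟩ := h' i
      have h5 : (e.1 i : ℝ) < e'.1 i + 1 := by linarith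
      have h6 : (e'.1 i : ℝ) < e.1 i + 1 := by linarith
      have h7 : e.1 i < e'.1 i + 1 := by exact_mod_cast h5
      have h8 : e'.1 i < e.1 i + 1 := by exact_mod_cast h6
      omega) hne
  · exfalso
    obtain ⟨h1, h2⟩ := h ⟨0, hd⟩
    rw [h'] at h1 h2
    simp only [corner] at h1 h2
    have h3 : e.1 ⟨0, hd⟩ < e'.2 ⟨0, hd⟩ := by exact_mod_cast h1
    have h4 : e'.2 ⟨0, hd⟩ < e.1 ⟨0, hd⟩ + 1 := by exact_mod_cast h2
    omega
  · exfalso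
    obtain ⟨h1, h2⟩ := h' ⟨0, hd⟩
    simp only [corner] at h1 h2
    have h3 : e'.1 ⟨0, hd⟩ < e.2 ⟨0, hd⟩ := by exact_mod_cast h1
    have h4 : e.2 ⟨0, hd⟩ < e'.1 ⟨0, hd⟩ + 1 := by exact_mod_cast h2
    omega
  · funext i
    have := congr_fun h' i
    simp only [corner] at this
    exact_mod_cast this

/-- Carriers are closed. [folklore] -/
theorem isClosed_carrier (T : List (Seg d)) : IsClosed (carrier T) := by
  induction T with
  | nil => simp
  | cons s T ih => rw [carrier_cons]; exact (isClosed_segment' s).union ih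

/-! ## Part 5. The count along a chain of centres (any d, any block constants) -/

section Chain

variable (EF : Finset (Pt d × Pt d))

/-- The edges whose centre lies in R. [folklore] -/
def edgesAt (R : Finset (Pt d)) : Finset (Pt d × Pt d) := EF.filter fun e => e.1 ∈ R

/-- The cubes at the vertex ends of the edges whose centre lies in R. [folklore] -/
def cubesAt (R : Finset (Pt d)) : Finset (Pt d) := (edgesAt EF R).biUnion fun e => touch e.2

/-- The centres of a set of edges. [folklore] -/
def centres : Finset (Pt d) := EF.image Prod.fst

/-- THE CHAIN COUNT.  If every centre c obeys the block bound q·#(cubes at the vertex ends of its edges) ≤ q·2^d +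
a·#(edges at c), and every proper non-empty set R of centres has an edge sharing its VERTEX END with an edge of a centre
outside R (this is what connectedness of the carrier gives, Part 6), then q·#(all cubes at vertex ends) ≤ q·2^d + a·#edges:
grow R one centre at a time; the shared vertex s makes the 2^d cubes of `touch s` common to the old and the new block,
which pays the additive constant of the new block. [folklore] -/
theorem chain_count (q a : ℕ)
    (hblock : ∀ c ∈ centres EF, q * (cubesAt EF {c}).card ≤ q * 2 ^ d + a * (edgesAt EF {c}).card)
    (hconn : ∀ R, R ⊆ centres EF → R.Nonempty → R ≠ centres EF →
      ∃ c ∈ centres EF, c ∉ R ∧ ∃ s, (∃ c' ∈ R, (c', s) ∈ EF) ∧ (c, s) ∈ EF)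
    (hne : (centres EF).Nonempty) :
    q * (cubesAt EF (centres EF)).card ≤ q * 2 ^ d + a * EF.card := by
  classical
  have key : ∀ (n : ℕ) (R : Finset (Pt d)), R ⊆ centres EF → R.Nonempty →
      q * (cubesAt EF R).card ≤ q * 2 ^ d + a * (edgesAt EF R).card → (centres EF \ R).card = n →
      q * (cubesAt EF (centres EF)).card ≤ q * 2 ^ d + a * EF.card := by
    intro n
    induction n with
    | zero =>
      intro R hR _ hb hcard
      have hRc : R = centres EF :=
        Subset.antisymm hR (sdiff_eq_empty_iff_subset.1 (Finset.card_eq_zero.1 hcard))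
      rw [hRc] at hb
      have hE : edgesAt EF (centres EF) = EF :=
        filter_true_of_mem fun e he => mem_image_of_mem Prod.fst he
      rwa [hE] at hb
    | succ n ih =>
      intro R hR hRne hb hcard
      have hRne' : R ≠ centres EF := by
        rintro rfl
        simp at hcard
      obtain ⟨c, hc, hcR, s, ⟨c', hc'R, hc's⟩, hcs⟩ := hconn R hR hRne hRne'
      refine ih (insert c R) (insert_subset hc hR) (insert_nonempty c R) ?_ ?_
      · have hE : edgesAt EF (insert c R) = edgesAt EF {c} ∪ edgesAt EF R := by
          ext e
          simp only [edgesAt, mem_filter, mem_insert, mem_union, mem_singleton]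
          tauto
        have hdisj : Disjoint (edgesAt EF {c}) (edgesAt EF R) := by
          rw [edgesAt, edgesAt, disjoint_filter]
          intro e _ h1 h2
          rw [mem_singleton] at h1
          exact hcR (h1 ▸ h2)
        have hC : cubesAt EF (insert c R) = cubesAt EF {c} ∪ cubesAt EF R := by
          rw [cubesAt, hE, union_biUnion]
          rfl
        have hts : touch s ⊆ cubesAt EF {c} ∩ cubesAt EF R := by
          intro y hy
          simp only [cubesAt, edgesAt, mem_inter, mem_biUnion, mem_filter, mem_singleton]
          exact ⟨⟨(c, s), ⟨hcs, rfl⟩, hy⟩, ⟨(c', s), ⟨hc's, hc'R⟩, hy⟩⟩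
        have hint : 2 ^ d ≤ (cubesAt EF {c} ∩ cubesAt EF R).card := by
          have := card_le_card hts
          rwa [card_touch] at this
        have hunion := card_union_add_card_inter (cubesAt EF {c}) (cubesAt EF R)
        have hblk := hblock c hc
        rw [hC, hE, card_union_of_disjoint hdisj]
        have h1 : q * (cubesAt EF {c} ∪ cubesAt EF R).card + q * (cubesAt EF {c} ∩ cubesAt EF R).card
            = q * (cubesAt EF {c}).card + q * (cubesAt EF R).card := by
          rw [← mul_add, hunion, mul_add]
        have h2 : q * 2 ^ d ≤ q * (cubesAt EF {c} ∩ cubesAt EF R).card := Nat.mul_le_mul_left q hint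
        have h3 : a * ((edgesAt EF {c}).card + (edgesAt EF R).card)
            = a * (edgesAt EF {c}).card + a * (edgesAt EF R).card := mul_add _ _ _
        rw [h3]
        omega
      · rw [sdiff_insert, card_erase_of_mem (mem_sdiff.2 ⟨hc, hcR⟩), hcard]
        rfl
  obtain ⟨c0, hc0⟩ := hne
  exact key _ {c0} (singleton_subset_iff.2 hc0) (singleton_nonempty c0) (hblock c0 hc0) rfl

end Chain

/-! ## Part 6. Half-lattice graphs: the cubes met, and what connectedness gives -/

/-- The cubes met by a half-lattice graph are among the cubes at the vertex ends of its edges. [folklore] -/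
theorem subset_cubesAt {E : List (Pt d × Pt d)} (hE : ∀ e ∈ E, IsHL e) {Y : Finset (Pt d)}
    (hY : ∀ y ∈ Y, (carrier (hgraph E) ∩ cube y).Nonempty) : Y ⊆ cubesAt E.toFinset (centres E.toFinset) := by
  classical
  intro y hy
  obtain ⟨p, hp, hpy⟩ := hY y hy
  obtain ⟨e, he, hpe⟩ := mem_carrier_hgraph.1 hp
  exact mem_biUnion.2 ⟨e, mem_filter.2 ⟨List.mem_toFinset.2 he, mem_image_of_mem _ (List.mem_toFinset.2 he)⟩,
    mem_touch_of_meets (hE e he) hpe hpy⟩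

/-- An edge of a list with prescribed centre. [folklore] -/
theorem exists_edge_of_mem_centres {E : List (Pt d × Pt d)} {c : Pt d} (hc : c ∈ centres E.toFinset) :
    ∃ e ∈ E, e.1 = c := by
  classical
  obtain ⟨e, he, hec⟩ := mem_image.1 hc
  exact ⟨e, List.mem_toFinset.1 he, hec⟩

/-- WHAT CONNECTEDNESS GIVES (d ≥ 1): if the carrier of a half-lattice graph is preconnected, every proper non-empty set
R of its centres has an edge sharing its vertex end with an edge of a centre outside R — the closed cover of the carrier by
the segments with centre in R and the segments with centre outside R must overlap, and two segments with different centres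
meet only at a common vertex end (`snd_eq_of_mem_segment`). [folklore] -/
theorem shared_vertex_of_isPreconnected (hd : 0 < d) {E : List (Pt d × Pt d)} (hE : ∀ e ∈ E, IsHL e)
    (hpc : IsPreconnected (carrier (hgraph E))) :
    ∀ R, R ⊆ centres E.toFinset → R.Nonempty → R ≠ centres E.toFinset →
      ∃ c ∈ centres E.toFinset, c ∉ R ∧ ∃ s, (∃ c' ∈ R, (c', s) ∈ E.toFinset) ∧ (c, s) ∈ E.toFinset := by
  classical
  intro R hR hRne hRc
  obtain ⟨U, hU⟩ : ∃ U : Set (RPt d), U = carrier (hgraph (E.filter fun e => e.1 ∈ R)) := ⟨_, rfl⟩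
  obtain ⟨V, hV⟩ : ∃ V : Set (RPt d), V = carrier (hgraph (E.filter fun e => e.1 ∉ R)) := ⟨_, rfl⟩
  have hcov : carrier (hgraph E) ⊆ U ∪ V := by
    intro p hp
    obtain ⟨e, he, hpe⟩ := mem_carrier_hgraph.1 hp
    by_cases h : e.1 ∈ R
    · left
      rw [hU]
      exact mem_carrier_hgraph.2 ⟨e, List.mem_filter.2 ⟨he, by simpa using h⟩, hpe⟩
    · right
      rw [hV]
      exact mem_carrier_hgraph.2 ⟨e, List.mem_filter.2 ⟨he, by simpa using h⟩, hpe⟩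
  obtain ⟨c', hc'⟩ := hRne
  obtain ⟨e₁, he₁, he₁c⟩ := exists_edge_of_mem_centres (hR hc')
  have hU1 : (carrier (hgraph E) ∩ U).Nonempty := by
    refine ⟨ctr e₁.1, mem_carrier_hgraph.2 ⟨e₁, he₁, left_mem_segment ℝ _ _⟩, ?_⟩
    rw [hU]
    exact mem_carrier_hgraph.2 ⟨e₁, List.mem_filter.2 ⟨he₁, by simpa [he₁c] using hc'⟩, left_mem_segment ℝ _ _⟩
  obtain ⟨c, hc, hcR⟩ : ∃ c ∈ centres E.toFinset, c ∉ R :=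
    not_subset.1 fun h => hRc (Subset.antisymm hR h)
  obtain ⟨e₂, he₂, he₂c⟩ := exists_edge_of_mem_centres hc
  have hV1 : (carrier (hgraph E) ∩ V).Nonempty := by
    refine ⟨ctr e₂.1, mem_carrier_hgraph.2 ⟨e₂, he₂, left_mem_segment ℝ _ _⟩, ?_⟩
    rw [hV]
    exact mem_carrier_hgraph.2 ⟨e₂, List.mem_filter.2 ⟨he₂, by simpa [he₂c] using hcR⟩, left_mem_segment ℝ _ _⟩
  have hUc : IsClosed U := by rw [hU]; exact isClosed_carrier _
  have hVc : IsClosed V := by rw [hV]; exact isClosed_carrier _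
  obtain ⟨p, -, hpU, hpV⟩ := (isPreconnected_closed_iff.1 hpc) U V hUc hVc hcov hU1 hV1
  rw [hU] at hpU
  rw [hV] at hpV
  obtain ⟨f, hf, hpf⟩ := mem_carrier_hgraph.1 hpU
  obtain ⟨g, hg, hpg⟩ := mem_carrier_hgraph.1 hpV
  rw [List.mem_filter] at hf hg
  have hf1 : f.1 ∈ R := by simpa using hf.2
  have hg1 : g.1 ∉ R := by simpa using hg.2
  have hne : g.1 ≠ f.1 := fun h => hg1 (h ▸ hf1)
  have hs : g.2 = f.2 := snd_eq_of_mem_segment hd (hE g hg.1) (hE f hf.1) hne hpg hpf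
  refine ⟨g.1, mem_image_of_mem _ (List.mem_toFinset.2 hg.1), hg1, g.2, ⟨f.1, hf1, ?_⟩, ?_⟩
  · rw [hs]
    exact List.mem_toFinset.2 hf.1
  · exact List.mem_toFinset.2 hg.1

/-- From a VERTEX-SET BOUND for one cube (k ≥ 1 vertices of one unit cube lie on at most 2^d + (a/q)·k unit cubes) to the
block hypothesis of the chain count. [folklore] -/
theorem block_of_vertexBound (EF : Finset (Pt d × Pt d)) (hE : ∀ e ∈ EF, IsHL e) (q a : ℕ)
    (hvb : ∀ (c : Pt d) (N : Finset (Pt d)), (∀ s ∈ N, IsVertexOf c s) → N.Nonempty →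
      q * (N.biUnion touch).card ≤ q * 2 ^ d + a * N.card) :
    ∀ c ∈ centres EF, q * (cubesAt EF {c}).card ≤ q * 2 ^ d + a * (edgesAt EF {c}).card := by
  classical
  intro c hc
  have hN : cubesAt EF {c} = ((edgesAt EF {c}).image Prod.snd).biUnion touch := by
    rw [cubesAt, image_biUnion]
  rw [hN]
  have hv : ∀ s ∈ (edgesAt EF {c}).image Prod.snd, IsVertexOf c s := by
    intro s hs
    obtain ⟨e, he, rfl⟩ := mem_image.1 hs
    rw [edgesAt, mem_filter, mem_singleton] at he
    rw [← he.2]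
    exact hE e he.1
  have hne : ((edgesAt EF {c}).image Prod.snd).Nonempty := by
    obtain ⟨e, he, hec⟩ := mem_image.1 hc
    exact ⟨e.2, mem_image.2 ⟨e, mem_filter.2 ⟨he, by rw [mem_singleton]; exact hec⟩, rfl⟩⟩
  have h1 := hvb c _ hv hne
  have h2 : ((edgesAt EF {c}).image Prod.snd).card ≤ (edgesAt EF {c}).card := card_image_le
  exact h1.trans (Nat.add_le_add_left (Nat.mul_le_mul_left a h2) _)

/-- THE HALF-LATTICE COUNT (any d ≥ 1, any block constants q, a): if k ≥ 1 vertices of one unit cube always lie on at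
most 2^d + (a/q)·k unit cubes, then a connected half-lattice graph with n edges (sup-length n/2) meets at most 2^d + (a/q)·n
unit cubes: q·#Y ≤ q·2^d + a·n. [folklore] -/
theorem halfLattice_count (hd : 0 < d) (q a : ℕ)
    (hvb : ∀ (c : Pt d) (N : Finset (Pt d)), (∀ s ∈ N, IsVertexOf c s) → N.Nonempty →
      q * (N.biUnion touch).card ≤ q * 2 ^ d + a * N.card)
    {E : List (Pt d × Pt d)} (hE : ∀ e ∈ E, IsHL e) {Y : Finset (Pt d)} (hY : SAdmissible Y (hgraph E)) :
    q * Y.card ≤ q * 2 ^ d + a * E.length := by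
  classical
  have hEne : E ≠ [] := by
    rintro rfl
    have := hY.connected.nonempty
    simp [hgraph] at this
  have hcne : (centres E.toFinset).Nonempty := by
    obtain ⟨e, he⟩ := List.exists_mem_of_ne_nil E hEne
    exact ⟨e.1, mem_image_of_mem _ (List.mem_toFinset.2 he)⟩
  have hEF : ∀ e ∈ E.toFinset, IsHL e := fun e he => hE e (List.mem_toFinset.1 he)
  have hchain := chain_count E.toFinset q a (block_of_vertexBound E.toFinset hEF q a hvb)
    (shared_vertex_of_isPreconnected hd hE hY.connected.isPreconnected) hcne
  have hsub := card_le_card (subset_cubesAt hE hY.meets)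
  have hEc : E.toFinset.card ≤ E.length := List.toFinset_card_le E
  exact (Nat.mul_le_mul_left q hsub).trans (hchain.trans (Nat.add_le_add_left (Nat.mul_le_mul_left a hEc) _))

/-! ## Part 7. d = 3 and d = 4: the half-lattice slopes are exactly 15/2 and 35/2 -/

/-- THE HALF-LATTICE CEILING AT d = 3 (integer form): a connected half-lattice graph with n edges meets at most 8 + 15n/4
unit cubes. [folklore] -/
theorem four_mul_card_le_three {E : List (Pt 3 × Pt 3)} (hE : ∀ e ∈ E, IsHL e) {Y : Finset (Pt 3)}
    (hY : SAdmissible Y (hgraph E)) : 4 * Y.card ≤ 32 + 15 * E.length := by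
  have h := halfLattice_count (d := 3) (by norm_num) 4 15 block_bound_three hE hY
  norm_num at h
  exact h

/-- THE HALF-LATTICE CEILING AT d = 3: a connected half-lattice graph meets at most (15/2)·len + 2^3 unit cubes. [folklore] -/
theorem halfLattice_count_three {E : List (Pt 3 × Pt 3)} (hE : ∀ e ∈ E, IsHL e) {Y : Finset (Pt 3)}
    (hY : SAdmissible Y (hgraph E)) : (Y.card : ℝ) ≤ 15 / 2 * len (hgraph E) + 2 ^ 3 := by
  have h2 := four_mul_card_le_three hE hY
  have h3 : (4 : ℝ) * Y.card ≤ 32 + 15 * E.length := by exact_mod_cast h2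
  rw [len_hgraph (by norm_num) hE]
  linarith

/-- The star `S3` (even-weight code) as a half-lattice graph. [folklore] -/
def E3 : List (Pt 3 × Pt 3) := S3.map fun s => (0, s)

/-- Its edges are half-lattice edges. [folklore] -/
theorem E3_isHL : ∀ e ∈ E3, IsHL e := by
  simp only [IsHL, IsVertexOf, E3, S3]
  decide

/-- Its graph is the centre star of `S3`. [folklore] -/
theorem hgraph_E3 : hgraph E3 = ctrStar S3 := by
  simp [hgraph, E3, ctrStar, hseg]

/-- THE HALF-LATTICE FLOOR AT d = 3: any slope valid on the half-lattice family is ≥ 15/2 (the star `S3`: 23 cubes,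
length 2). [folklore] -/
theorem halfLattice_floor_three {c : ℝ}
    (h : ∀ (E : List (Pt 3 × Pt 3)), (∀ e ∈ E, IsHL e) → ∀ (Y : Finset (Pt 3)), SAdmissible Y (hgraph E) →
      (Y.card : ℝ) ≤ c * len (hgraph E) + 2 ^ 3) : (15 : ℝ) / 2 ≤ c := by
  have h1 := h E3 E3_isHL (starCubes S3) (by rw [hgraph_E3]; exact sAdmissible_ctrStar (by simp [S3]))
  rw [hgraph_E3, card_starCubes_S3, len_ctrStar_S3] at h1
  norm_num at h1
  linarith

/-- THE HALF-LATTICE SLOPE AT d = 3 IS EXACTLY 15/2. [folklore] -/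
theorem halfLattice_slope_three :
    IsLeast {c : ℝ | ∀ (E : List (Pt 3 × Pt 3)), (∀ e ∈ E, IsHL e) → ∀ (Y : Finset (Pt 3)),
      SAdmissible Y (hgraph E) → (Y.card : ℝ) ≤ c * len (hgraph E) + 2 ^ 3} (15 / 2) :=
  ⟨fun _ hE _ hY => halfLattice_count_three hE hY, fun _ hc => halfLattice_floor_three hc⟩

/-- THE HALF-LATTICE CEILING AT d = 4 (integer form): a connected half-lattice graph with n edges meets at most 16 + 35n/4
unit cubes. [folklore] -/
theorem four_mul_card_le_four {E : List (Pt 4 × Pt 4)} (hE : ∀ e ∈ E, IsHL e) {Y : Finset (Pt 4)}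
    (hY : SAdmissible Y (hgraph E)) : 4 * Y.card ≤ 64 + 35 * E.length := by
  have h := halfLattice_count (d := 4) (by norm_num) 4 35 block_bound_four hE hY
  norm_num at h
  exact h

/-- THE HALF-LATTICE CEILING AT d = 4: a connected half-lattice graph (every segment joins the centre of a unit cube to one
of its vertices; sup-length ½ each) meets at most (35/2)·len + 2^4 unit cubes. [folklore] -/
theorem halfLattice_count_four {E : List (Pt 4 × Pt 4)} (hE : ∀ e ∈ E, IsHL e) {Y : Finset (Pt 4)}
    (hY : SAdmissible Y (hgraph E)) : (Y.card : ℝ) ≤ 35 / 2 * len (hgraph E) + 2 ^ 4 := by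
  have h2 := four_mul_card_le_four hE hY
  have h3 : (4 : ℝ) * Y.card ≤ 64 + 35 * E.length := by exact_mod_cast h2
  rw [len_hgraph (by norm_num) hE]
  linarith

/-- The star `S4` as a half-lattice graph: the edges (0, s), s ∈ S4. [folklore] -/
def E4 : List (Pt 4 × Pt 4) := S4.map fun s => (0, s)

/-- Its edges are half-lattice edges. [folklore] -/
theorem E4_isHL : ∀ e ∈ E4, IsHL e := by
  simp only [IsHL, IsVertexOf, E4, S4]
  decide

/-- Its graph is the centre star of `S4`. [folklore] -/
theorem hgraph_E4 : hgraph E4 = ctrStar S4 := by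
  simp [hgraph, E4, ctrStar, hseg]

/-- THE HALF-LATTICE FLOOR AT d = 4: any slope valid on the half-lattice family is ≥ 35/2 (the star `S4`: 51 cubes,
length 2). [folklore] -/
theorem halfLattice_floor_four {c : ℝ}
    (h : ∀ (E : List (Pt 4 × Pt 4)), (∀ e ∈ E, IsHL e) → ∀ (Y : Finset (Pt 4)), SAdmissible Y (hgraph E) →
      (Y.card : ℝ) ≤ c * len (hgraph E) + 2 ^ 4) : (35 : ℝ) / 2 ≤ c := by
  have h1 := h E4 E4_isHL (starCubes S4) (by rw [hgraph_E4]; exact sAdmissible_S4)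
  rw [hgraph_E4, card_starCubes_S4, len_ctrStar_S4] at h1
  norm_num at h1
  linarith

/-- THE HALF-LATTICE SLOPE AT d = 4 IS EXACTLY 35/2: the least c with `#Y ≤ c·len T + 2^4` for every connected
half-lattice graph T and every family Y of unit cubes met by T. [folklore] -/
theorem halfLattice_slope_four :
    IsLeast {c : ℝ | ∀ (E : List (Pt 4 × Pt 4)), (∀ e ∈ E, IsHL e) → ∀ (Y : Finset (Pt 4)),
      SAdmissible Y (hgraph E) → (Y.card : ℝ) ≤ c * len (hgraph E) + 2 ^ 4} (35 / 2) :=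
  ⟨fun _ hE _ hY => halfLattice_count_four hE hY, fun _ hc => halfLattice_floor_four hc⟩

/-- COROLLARY (numerics of the printed constant): on the half-lattice family — the family that refutes the conjectured
tree slope 2^4 − 1 = 15 (`SupCountBranching.conj_slope_fails_four`) — the count with the printed slope 3·2^{4−1} = 24
holds, with room: #Y ≤ 24·len T + 2^4. [folklore] -/
theorem halfLattice_printed_slope_four {E : List (Pt 4 × Pt 4)} (hE : ∀ e ∈ E, IsHL e) {Y : Finset (Pt 4)}
    (hY : SAdmissible Y (hgraph E)) : (Y.card : ℝ) ≤ 3 * 2 ^ (4 - 1) * len (hgraph E) + 2 ^ 4 := by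
  have h1 := halfLattice_count_four hE hY
  have hl := len_nonneg (hgraph E)
  norm_num at h1 ⊢
  nlinarith

/-! ## Part 8 (v1.1, append-only). The family is characterised by sup-length ½
Types the header's «exactly»: a centre-to-lattice-point segment has sup-length ½ iff it is a half-lattice edge, and
otherwise has sup-length ≥ 3/2 (XREAD INFO I-1 of cell record C-pv22g18-4). [folklore] -/

/-- Coordinatewise (integers a = c_μ, b = s_μ): |a + ½ − b| ≤ ½ forces b ∈ {a, a + 1}. [folklore] -/
theorem vertex_coord_of_abs_le_half {a b : ℤ} (h : |((a : ℝ) + 1 / 2) - b| ≤ 1 / 2) : b = a ∨ b = a + 1 := by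
  rcases abs_le.1 h with ⟨h1, h2⟩
  have h3 : (a : ℝ) ≤ b := by linarith
  have h4 : (b : ℝ) ≤ a + 1 := by linarith
  have h3' : a ≤ b := by exact_mod_cast h3
  have h4' : b ≤ a + 1 := by exact_mod_cast h4
  omega

/-- Coordinatewise, the other case: b ∉ {a, a + 1} forces |a + ½ − b| ≥ 3/2. [folklore] -/
theorem three_halves_le_abs_of_ne {a b : ℤ} (h1 : b ≠ a) (h2 : b ≠ a + 1) : 3 / 2 ≤ |((a : ℝ) + 1 / 2) - b| := by
  by_cases h3 : b ≤ a - 1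
  · have h4 : (b : ℝ) ≤ a - 1 := by exact_mod_cast h3
    rw [abs_of_nonneg (by linarith)]
    linarith
  · have h5 : a + 2 ≤ b := by omega
    have h6 : (a : ℝ) + 2 ≤ b := by exact_mod_cast h5
    rw [abs_of_nonpos (by linarith)]
    linarith

/-- CHARACTERISATION (d ≥ 1): the segment from the centre of cube c to the lattice point s has sup-length ½ iff s is a
vertex of c, i.e. iff (c, s) is a half-lattice edge. [folklore] -/
theorem isHL_iff_dist_eq_half (hd : 0 < d) (c s : Pt d) : IsHL (c, s) ↔ dist (ctr c) (corner s) = 1 / 2 := by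
  refine ⟨fun h => by simpa only [hseg] using dist_hseg hd h, fun h => ?_⟩
  show ∀ i, s i = c i ∨ s i = c i + 1
  intro i
  have hi := dist_le_pi_dist (ctr c) (corner s) i
  rw [h, Real.dist_eq, SupCountCeiling.ctr, corner] at hi
  exact vertex_coord_of_abs_le_half hi

/-- THE GAP (any d): a centre-to-lattice-point segment that is not a half-lattice edge has sup-length ≥ 3/2. [folklore] -/
theorem three_halves_le_dist_of_not_isHL {c s : Pt d} (h : ¬ IsHL (c, s)) : 3 / 2 ≤ dist (ctr c) (corner s) := by
  have h' : ¬ ∀ i, s i = c i ∨ s i = c i + 1 := h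
  obtain ⟨i, hi⟩ := not_forall.1 h'
  obtain ⟨h1, h2⟩ := not_or.1 hi
  have h3 : (3 : ℝ) / 2 ≤ dist (ctr c i) (corner s i) := by
    rw [Real.dist_eq, SupCountCeiling.ctr, corner]
    exact three_halves_le_abs_of_ne h1 h2
  exact h3.trans (dist_le_pi_dist (ctr c) (corner s) i)

/-- COROLLARY (d ≥ 1): a list of (centre, lattice point) pairs all of whose segments have sup-length ½ is a half-lattice
graph — the hypothesis `∀ e ∈ E, IsHL e` of `halfLattice_slope_four` is exactly «every segment has sup-length ½». [folklore] -/
theorem isHL_of_forall_dist (hd : 0 < d) {E : List (Pt d × Pt d)}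
    (hE : ∀ e ∈ E, dist (hseg e).1 (hseg e).2 = 1 / 2) : ∀ e ∈ E, IsHL e := by
  intro e he
  have h := hE e he
  simp only [hseg] at h
  exact (isHL_iff_dist_eq_half hd e.1 e.2).2 h

/-- … and conversely (restating `dist_hseg` at list level), so the two descriptions of the family coincide. [folklore] -/
theorem forall_isHL_iff_forall_dist (hd : 0 < d) (E : List (Pt d × Pt d)) :
    (∀ e ∈ E, IsHL e) ↔ ∀ e ∈ E, dist (hseg e).1 (hseg e).2 = 1 / 2 :=
  ⟨fun hE e he => dist_hseg hd (hE e he), isHL_of_forall_dist hd⟩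

end Literature.MathematicalPhysics.QuantumFieldTheory.Balaban1983to89.B16.SupCountHalfLattice
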